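import Summits.AtomisticToContinuum.HydrodynamicLimit.Theorems.JParityClosureKineticEnergyTailsApriori
import Summits.AtomisticToContinuum.HydrodynamicLimit.Theses.JParityClosure
import HarnessLib

/-!
# `JParityClosure.KineticEnergyTails` (stmt-AtomisticToContinuum-13087) is equivalent to its
# in-probability form

The item asks for smallness IN EXPECTATION of the empirical quadratic velocity tail
`T_M(s, z) = (N+1)⁻¹ ∑ᵢ |vᵢ(Φ_s z)|² 𝟙{|vᵢ(Φ_s z)| > M}` under the local Gibbs law, uniformly in
`N ≥ N₀` and `s ∈ [0, t]`. This file proves, unconditionally, that it is EQUIVALENT to the (a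
priori weaker) smallness IN PROBABILITY of the same functional:

* `kineticEnergyTails_iff_inProbability : KineticEnergyTails ↔ (∀ profiles ∃ σ₀ ∀ σ < σ₀ ∀ Euler
  data ∀ flows, LLN at 0 → ∀ t < T ∀ ε δ > 0 ∃ M N₀ ∀ N ≥ N₀ ∀ s ∈ [0,t],
  λ^N {z | δ < T_M(s, z)} ≤ ε)`.

`→` is Markov's inequality. `←` is the a-priori half of the item
(`JParityClosureKineticEnergyTailsApriori.lean`): pathwise energy conservation dominates
`T_M(s, ·)` by the time-zero mean kinetic energy `Y = (N+1)⁻¹ ∑ᵢ |vᵢ(0)|²`, whose second moment is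
bounded uniformly in `N` and `σ` by the fourth Gaussian moment (`Y² ≤ (N+1)⁻¹ ∑ᵢ |vᵢ|⁴`,
disintegration), so the family `{T_M(s, ·)}` is uniformly integrable as soon as it is tight in
probability: pointwise `T ≤ δ + Y²/K + K 𝟙{T > δ}`, integrate, and choose `δ = ε/3`,
`K = 3(C₄+1)/ε`, `ε' = ε/(3K)`.

So the open content of the item is exactly: no energy `δ (N+1)` is carried, with non-vanishing
probability, by particles faster than `M`, at some time `s ≤ t` — a statement refuters can attack
through probabilities of events and planners can feed from any convergence-in-probability
mechanism.
-/

noncomputable section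

namespace Summit.AtomisticToContinuum.HydrodynamicLimit.Theorems

open MeasureTheory ProbabilityTheory Set Filter
open scoped ENNReal BigOperators
open Literature.MathematicalPhysics.KineticTheory Literature.Analysis.FluidPDE
open Summit.AtomisticToContinuum.HydrodynamicLimit.Theses.JParityClosure

section InProbability

variable {a₀ θ₀ : T3 → ℝ} {u₀ : T3 → V3}

/-! ### Measurability of the tail functional and the fourth-moment bound -/

/-- The empirical quadratic velocity tail at time `s` is a measurable function of the initial
datum (the time-`s` map of a hard-sphere flow is measurable). -/
theorem measurable_tailEnergy_flow {ε : ℝ} {n : ℕ}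
    (Φ : HardSphereFlow (Torus.geometry (Fin 3)) ε n) (c M s : ℝ) :
    Measurable fun z : Config n (Fin 3) T3 => c * ∑ i,
      Set.indicator {v : V3 | M < ‖v‖} (fun v => ‖v‖ ^ 2) ((Φ.flow s z i).2) := by
  refine measurable_const.mul (Finset.measurable_sum _ fun i _ => ?_)
  have hind : Measurable (Set.indicator {v : V3 | M < ‖v‖} (fun v : V3 => ‖v‖ ^ 2)) :=
    (measurable_norm.pow_const 2).indicator (measurableSet_lt measurable_const measurable_norm)
  exact hind.comp ((measurable_pi_apply i).comp (Φ.measurable_flow s)).snd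

/-- The fourth Gaussian moment bounds the mean fourth velocity moment under the local Gibbs
measure: `∫ (N+1)⁻¹ ∑ᵢ |vᵢ|⁴ / K dλ^N ≤ 8 (U⁴ + Θ² K₄) / K` (`K > 0`; disintegration lemma
`lintegral_meanVelObs_localGibbsMeasure_le` with `f = |·|⁴ / K`). -/
theorem lintegral_meanFourth_div_le (ha : Continuous a₀) (hθ : Continuous θ₀) (hu : Continuous u₀)
    (ha0 : ∀ x, 0 ≤ a₀ x) (hθ0 : ∀ x, 0 < θ₀ x) {U Θ : ℝ} (hU : ∀ x, ‖u₀ x‖ ≤ U)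
    (hΘ : ∀ x, θ₀ x ≤ Θ) {K : ℝ} (hK : 0 < K) (σ : ℝ) (N : ℕ) :
    ∫⁻ z, ENNReal.ofReal (((N : ℝ) + 1)⁻¹ * ∑ i, ‖(z i).2‖ ^ 4 / K)
        ∂localGibbsMeasure σ a₀ u₀ θ₀ N ≤
      ENNReal.ofReal (8 * (U ^ 4 + Θ ^ 2 * ∫ w, ‖w‖ ^ 4 ∂stdGaussian V3) / K) := by
  refine lintegral_meanVelObs_localGibbsMeasure_le ha hθ hu ha0 hθ0
    (f := fun v : V3 => ‖v‖ ^ 4 / K) (by fun_prop) (fun v => by positivity) (fun y => ?_) σ N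
  rw [← ofReal_integral_eq_lintegral_ofReal
    ((integrable_norm_pow_four_gaussMeasure (u₀ y) (θ₀ y)).div_const K)
    (Eventually.of_forall fun v => by positivity), integral_div]
  refine ENNReal.ofReal_le_ofReal (div_le_div_of_nonneg_right ?_ hK.le)
  refine (integral_norm_pow_four_gaussMeasure_le (u₀ y) (hθ0 y)).trans ?_
  have hUy : ‖u₀ y‖ ^ 4 ≤ U ^ 4 := pow_le_pow_left₀ (norm_nonneg _) (hU y) 4
  have hΘy : θ₀ y ^ 2 ≤ Θ ^ 2 := pow_le_pow_left₀ (hθ0 y).le (hΘ y) 2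
  have hK4 : 0 ≤ ∫ w, ‖w‖ ^ 4 ∂stdGaussian V3 := integral_nonneg fun w => by positivity
  gcongr

/-! ### Tightness in probability plus the a-priori bounds give smallness in expectation -/

/-- Pointwise three-way split behind "tight in probability + `L²`-bounded dominating variable ⇒
small in expectation": for reals `0 ≤ T ≤ Y`, `K > 0` and any `δ`,
`T ≤ δ + Y²/K + K 𝟙{T > δ}` in `ℝ≥0∞`. -/
theorem ofReal_le_three_way_split {T Y δ K : ℝ} (hT0 : 0 ≤ T) (hTY : T ≤ Y) (hK : 0 < K) :
    ENNReal.ofReal T ≤ ENNReal.ofReal δ + ENNReal.ofReal (Y ^ 2 / K) +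
      Set.indicator {x : ℝ | δ < x} (fun _ => ENNReal.ofReal K) T := by
  by_cases hTδ : T ≤ δ
  · calc ENNReal.ofReal T ≤ ENNReal.ofReal δ := ENNReal.ofReal_le_ofReal hTδ
      _ ≤ _ := le_add_right (le_add_right le_rfl)
  · rw [Set.indicator_of_mem (show T ∈ {x : ℝ | δ < x} from lt_of_not_ge hTδ)]
    by_cases hYK : Y ≤ K
    · calc ENNReal.ofReal T ≤ ENNReal.ofReal K := ENNReal.ofReal_le_ofReal (hTY.trans hYK)
        _ ≤ _ := le_add_left le_rfl
    · have hKY : K < Y := lt_of_not_ge hYK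
      have hY : T ≤ Y ^ 2 / K := by
        rw [le_div_iff₀ hK]
        calc T * K ≤ Y * Y := mul_le_mul hTY hKY.le hK.le (hT0.trans hTY)
          _ = Y ^ 2 := (sq Y).symm
      calc ENNReal.ofReal T ≤ ENNReal.ofReal (Y ^ 2 / K) := ENNReal.ofReal_le_ofReal hY
        _ ≤ _ := le_add_right (le_add_left le_rfl)

/-- **Expectation of the tail functional from its probability.** For continuous profiles
(`a₀ ≥ 0`, `θ₀ > 0`, `‖u₀‖ ≤ U`, `θ₀ ≤ Θ`), `σ ≤ 1/2` WITH `a₀ > 0` (so that `λ^N` is a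
probability measure), every `N`, flow `Φ`, cut-off `M`, time `s`, level `δ` and `K > 0`:
`𝔼[T_M(s)] ≤ δ + 8 (U⁴ + Θ² K₄) / K + K · λ^N {δ < T_M(s)}` — energy conservation (`T ≤ Y` a.s.),
`Y² ≤ (N+1)⁻¹ ∑ᵢ |vᵢ|⁴`, the split `ofReal_le_three_way_split`, and the fourth-moment bound. -/
theorem lintegral_tailEnergy_le_of_measure (ha : Continuous a₀) (hθ : Continuous θ₀)
    (hu : Continuous u₀) (ha0 : ∀ x, 0 < a₀ x) (hθ0 : ∀ x, 0 < θ₀ x) {U Θ : ℝ}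
    (hU : ∀ x, ‖u₀ x‖ ≤ U) (hΘ : ∀ x, θ₀ x ≤ Θ) {σ : ℝ} (hσ2 : σ ≤ 1 / 2) (N : ℕ)
    (Φ : HardSphereFlow (Torus.geometry (Fin 3)) (hsDiameter σ N) (N + 1)) (M s δ : ℝ)
    {K : ℝ} (hK : 0 < K) :
    ∫⁻ z, ENNReal.ofReal (((N : ℝ) + 1)⁻¹ * ∑ i : Fin (N + 1),
        Set.indicator {v : V3 | M < ‖v‖} (fun v => ‖v‖ ^ 2) ((Φ.flow s z i).2))
        ∂(localGibbsLaw σ a₀ u₀ θ₀ N Φ) ≤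
      ENNReal.ofReal δ + ENNReal.ofReal (8 * (U ^ 4 + Θ ^ 2 * ∫ w, ‖w‖ ^ 4 ∂stdGaussian V3) / K) +
        ENNReal.ofReal K * localGibbsLaw σ a₀ u₀ θ₀ N Φ
          {z | δ < ((N : ℝ) + 1)⁻¹ * ∑ i : Fin (N + 1),
            Set.indicator {v : V3 | M < ‖v‖} (fun v => ‖v‖ ^ 2) ((Φ.flow s z i).2)} := by
  haveI : IsProbabilityMeasure (localGibbsLaw σ a₀ u₀ θ₀ N Φ) :=
    isProbabilityMeasure_localGibbsLaw ha hθ hu ha0 hθ0 hσ2 N Φ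
  set μ := localGibbsLaw σ a₀ u₀ θ₀ N Φ with hμ
  -- the tail functional `T`, the mean energy `Y` and the mean fourth moment `Q`
  set T : Config (N + 1) (Fin 3) T3 → ℝ := fun z => ((N : ℝ) + 1)⁻¹ * ∑ i : Fin (N + 1),
    Set.indicator {v : V3 | M < ‖v‖} (fun v => ‖v‖ ^ 2) ((Φ.flow s z i).2) with hT
  set Q : Config (N + 1) (Fin 3) T3 → ℝ := fun z => ((N : ℝ) + 1)⁻¹ * ∑ i : Fin (N + 1),
    ‖(z i).2‖ ^ 4 / K with hQ
  set B : Set (Config (N + 1) (Fin 3) T3) := {z | δ < T z} with hB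
  have hTm : Measurable T := measurable_tailEnergy_flow Φ _ M s
  have hBm : MeasurableSet B := measurableSet_lt measurable_const hTm
  have hQm : Measurable fun z => ENNReal.ofReal (Q z) := by
    refine (measurable_const.mul (Finset.measurable_sum _ fun i _ => ?_)).ennreal_ofReal
    exact ((measurable_pi_apply i).snd.norm.pow_const 4).div_const K
  -- pointwise (almost surely): `T ≤ δ + Q + K 𝟙_B`
  have hgood : ∀ᵐ z ∂μ, z ∈ Φ.good := by
    rw [hμ, localGibbsLaw_eq]
    exact (localGibbsMeasure_absolutelyContinuous σ a₀ u₀ θ₀ N Φ).ae_le Φ.ae_mem_good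
  have hpt : ∀ᵐ z ∂μ, ENNReal.ofReal (T z) ≤
      (ENNReal.ofReal δ + ENNReal.ofReal (Q z)) + B.indicator (fun _ => ENNReal.ofReal K) z := by
    filter_upwards [hgood] with z hz
    have hN : (0 : ℝ) < (N : ℝ) + 1 := by positivity
    set Y : ℝ := ((N : ℝ) + 1)⁻¹ * ∑ i : Fin (N + 1), ‖(z i).2‖ ^ 2 with hY
    have hT0 : 0 ≤ T z := mul_nonneg (inv_nonneg.2 hN.le)
      (Finset.sum_nonneg fun i _ => Set.indicator_nonneg (fun w _ => sq_nonneg _) _)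
    have hTY : T z ≤ Y :=
      mul_le_mul_of_nonneg_left (tailSum_flow_le_energySum Φ hz M s) (inv_nonneg.2 hN.le)
    -- `Y² ≤ (N+1)⁻¹ ∑ |vᵢ|⁴`, so `Y²/K ≤ Q z`
    have hY2 : Y ^ 2 / K ≤ Q z := by
      have hcs := sum_div_card_sq_le_sum_sq_div_card (s := (Finset.univ : Finset (Fin (N + 1))))
        (f := fun i => ‖(z i).2‖ ^ 2)
      simp only [Finset.card_univ, Fintype.card_fin, Nat.cast_add, Nat.cast_one] at hcs
      have hYeq : Y = (∑ i : Fin (N + 1), ‖(z i).2‖ ^ 2) / ((N : ℝ) + 1) := by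
        rw [hY, inv_mul_eq_div]
      have hQeq : Q z = ((∑ i : Fin (N + 1), (‖(z i).2‖ ^ 2) ^ 2) / ((N : ℝ) + 1)) / K := by
        simp only [hQ, Finset.sum_div, Finset.mul_sum]
        refine Finset.sum_congr rfl fun i _ => ?_
        rw [inv_mul_eq_div, ← pow_mul]
        ring
      rw [hYeq, hQeq]
      exact div_le_div_of_nonneg_right hcs hK.le
    have h3 := ofReal_le_three_way_split (δ := δ) hT0 hTY hK
    have hind : Set.indicator {x : ℝ | δ < x} (fun _ => ENNReal.ofReal K) (T z) =
        B.indicator (fun _ => ENNReal.ofReal K) z := by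
      by_cases hz' : δ < T z
      · rw [Set.indicator_of_mem (show T z ∈ {x : ℝ | δ < x} from hz'),
          Set.indicator_of_mem (show z ∈ B from hz')]
      · rw [Set.indicator_of_notMem (show T z ∉ {x : ℝ | δ < x} from hz'),
          Set.indicator_of_notMem (show z ∉ B from hz')]
    rw [hind] at h3
    exact h3.trans (by gcongr)
  -- integrate
  calc ∫⁻ z, ENNReal.ofReal (T z) ∂μ
      ≤ ∫⁻ z, (ENNReal.ofReal δ + ENNReal.ofReal (Q z)) + B.indicator (fun _ => ENNReal.ofReal K) z
          ∂μ := lintegral_mono_ae hpt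
    _ = (∫⁻ z, (ENNReal.ofReal δ + ENNReal.ofReal (Q z)) ∂μ) +
          ∫⁻ z, B.indicator (fun _ => ENNReal.ofReal K) z ∂μ :=
        lintegral_add_left (measurable_const.add hQm) _
    _ = ENNReal.ofReal δ + ∫⁻ z, ENNReal.ofReal (Q z) ∂μ + ENNReal.ofReal K * μ B := by
        rw [lintegral_add_left measurable_const, lintegral_const, measure_univ, mul_one,
          lintegral_indicator_const hBm]
    _ ≤ ENNReal.ofReal δ + ENNReal.ofReal (8 * (U ^ 4 + Θ ^ 2 * ∫ w, ‖w‖ ^ 4 ∂stdGaussian V3) / K)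
          + ENNReal.ofReal K * μ B := by
        gcongr
        rw [hμ, localGibbsLaw_eq]
        exact lintegral_meanFourth_div_le ha hθ hu (fun x => (ha0 x).le) hθ0 hU hΘ hK σ N

/-- **In-probability smallness of the quadratic velocity tail implies `KineticEnergyTails`.**
The hypothesis is the item with `∫ T_M(s) dλ^N ≤ ε` replaced by `λ^N {δ < T_M(s)} ≤ ε` (for all
`ε, δ > 0`). Proof: shrink `σ₀` below `1/2` (probability measures), bound `‖u₀‖ ≤ U`, `θ₀ ≤ Θ` by
compactness, and apply `lintegral_tailEnergy_le_of_measure` with `δ = ε/3`, `K = 3(C₄+1)/ε`,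
`ε' = ε/(3K)`. -/
theorem kineticEnergyTails_of_inProbability
    (h : ∀ (a₀ θ₀ : T3 → ℝ) (u₀ : T3 → V3), Continuous a₀ → Continuous θ₀ → Continuous u₀ →
      (∀ x, 0 < a₀ x) → (∀ x, 0 < θ₀ x) → ∃ σ₀ : ℝ, 0 < σ₀ ∧ ∀ σ : ℝ, 0 < σ → σ < σ₀ →
      ∀ (T : ℝ) (ρ θ : ℝ → T3 → ℝ) (u : ℝ → T3 → V3), IsHardSphereEulerSolution σ T ρ u θ →
      ∀ Φ : (N : ℕ) → HardSphereFlow (Torus.geometry (Fin 3)) (hsDiameter σ N) (N + 1),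
      TendstoHydroFieldsAt (fun N => localGibbsLaw σ a₀ u₀ θ₀ N (Φ N)) Φ ρ u θ 0 →
      ∀ t ∈ Set.Ico 0 T, ∀ ε : ℝ, 0 < ε → ∀ δ : ℝ, 0 < δ → ∃ M : ℝ, ∃ N₀ : ℕ, ∀ N : ℕ, N₀ ≤ N →
      ∀ s ∈ Set.Icc 0 t,
      localGibbsLaw σ a₀ u₀ θ₀ N (Φ N) {z | δ < ((N : ℝ) + 1)⁻¹ * ∑ i : Fin (N + 1),
        Set.indicator {v : V3 | M < ‖v‖} (fun v => ‖v‖ ^ 2) (((Φ N).flow s z i).2)} ≤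
        ENNReal.ofReal ε) :
    KineticEnergyTails := by
  intro a₀ θ₀ u₀ ha hθ hu ha0 hθ0
  obtain ⟨σ₀, hσ₀, hσ⟩ := h a₀ θ₀ u₀ ha hθ hu ha0 hθ0
  refine ⟨min σ₀ (1 / 2), lt_min hσ₀ (by norm_num), fun σ hσp hσl T ρ θ u hE Φ hLLN t ht ε hε => ?_⟩
  have hσ1 : σ < σ₀ := hσl.trans_le (min_le_left _ _)
  have hσ2 : σ ≤ 1 / 2 := (hσl.trans_le (min_le_right _ _)).le
  obtain ⟨U, -, hU⟩ := exists_forall_abs_le_of_continuous (χ := fun x => ‖u₀ x‖) hu.norm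
  obtain ⟨Θ, -, hΘ⟩ := exists_forall_abs_le_of_continuous hθ
  have hU' : ∀ x, ‖u₀ x‖ ≤ U := fun x => by
    have h := hU x
    rwa [abs_of_nonneg (norm_nonneg _)] at h
  have hΘ' : ∀ x, θ₀ x ≤ Θ := fun x => (le_abs_self _).trans (hΘ x)
  set C : ℝ := 8 * (U ^ 4 + Θ ^ 2 * ∫ w, ‖w‖ ^ 4 ∂stdGaussian V3) with hC
  have hC0 : 0 ≤ C := by
    have hK4 : 0 ≤ ∫ w, ‖w‖ ^ 4 ∂stdGaussian V3 := integral_nonneg fun w => by positivity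
    have hΘ0 : 0 ≤ Θ ^ 2 := sq_nonneg _
    positivity
  set K : ℝ := 3 * (C + 1) / ε with hK
  have hKpos : 0 < K := by positivity
  set ε' : ℝ := ε / (3 * K) with hε'
  have hε'pos : 0 < ε' := by positivity
  obtain ⟨M, N₀, hM⟩ := hσ σ hσp hσ1 T ρ θ u hE Φ hLLN t ht ε' hε'pos (ε / 3) (by positivity)
  refine ⟨M, N₀, fun N hN s hs => ?_⟩
  have hmain := lintegral_tailEnergy_le_of_measure ha hθ hu ha0 hθ0 hU' hΘ' hσ2 N (Φ N) M s
    (ε / 3) hKpos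
  refine hmain.trans ?_
  have h1 : C / K ≤ ε / 3 := by
    rw [hK, div_div_eq_mul_div, div_le_div_iff₀ (by positivity) (by positivity)]
    nlinarith
  have h2 : ENNReal.ofReal K * localGibbsLaw σ a₀ u₀ θ₀ N (Φ N)
      {z | ε / 3 < ((N : ℝ) + 1)⁻¹ * ∑ i : Fin (N + 1),
        Set.indicator {v : V3 | M < ‖v‖} (fun v => ‖v‖ ^ 2) (((Φ N).flow s z i).2)} ≤
      ENNReal.ofReal (ε / 3) := by
    calc _ ≤ ENNReal.ofReal K * ENNReal.ofReal ε' := mul_le_mul' le_rfl (hM N hN s hs)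
      _ = ENNReal.ofReal (K * ε') := (ENNReal.ofReal_mul hKpos.le).symm
      _ = ENNReal.ofReal (ε / 3) := by
          congr 1
          rw [hε']
          field_simp
  calc ENNReal.ofReal (ε / 3) + ENNReal.ofReal (C / K) + ENNReal.ofReal K *
        localGibbsLaw σ a₀ u₀ θ₀ N (Φ N) {z | ε / 3 < ((N : ℝ) + 1)⁻¹ * ∑ i : Fin (N + 1),
          Set.indicator {v : V3 | M < ‖v‖} (fun v => ‖v‖ ^ 2) (((Φ N).flow s z i).2)}
      ≤ ENNReal.ofReal (ε / 3) + ENNReal.ofReal (ε / 3) + ENNReal.ofReal (ε / 3) := by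
        gcongr
    _ = ENNReal.ofReal ε := by
        rw [← ENNReal.ofReal_add (by positivity) (by positivity),
          ← ENNReal.ofReal_add (by positivity) (by positivity)]
        congr 1
        ring

/-- **`KineticEnergyTails` implies its in-probability form** (Markov's inequality: for
`ε, δ > 0` apply the item with `ε δ` and divide by `δ`). -/
theorem inProbability_of_kineticEnergyTails (h : KineticEnergyTails) :
    ∀ (a₀ θ₀ : T3 → ℝ) (u₀ : T3 → V3), Continuous a₀ → Continuous θ₀ → Continuous u₀ →
      (∀ x, 0 < a₀ x) → (∀ x, 0 < θ₀ x) → ∃ σ₀ : ℝ, 0 < σ₀ ∧ ∀ σ : ℝ, 0 < σ → σ < σ₀ →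
      ∀ (T : ℝ) (ρ θ : ℝ → T3 → ℝ) (u : ℝ → T3 → V3), IsHardSphereEulerSolution σ T ρ u θ →
      ∀ Φ : (N : ℕ) → HardSphereFlow (Torus.geometry (Fin 3)) (hsDiameter σ N) (N + 1),
      TendstoHydroFieldsAt (fun N => localGibbsLaw σ a₀ u₀ θ₀ N (Φ N)) Φ ρ u θ 0 →
      ∀ t ∈ Set.Ico 0 T, ∀ ε : ℝ, 0 < ε → ∀ δ : ℝ, 0 < δ → ∃ M : ℝ, ∃ N₀ : ℕ, ∀ N : ℕ, N₀ ≤ N →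
      ∀ s ∈ Set.Icc 0 t,
      localGibbsLaw σ a₀ u₀ θ₀ N (Φ N) {z | δ < ((N : ℝ) + 1)⁻¹ * ∑ i : Fin (N + 1),
        Set.indicator {v : V3 | M < ‖v‖} (fun v => ‖v‖ ^ 2) (((Φ N).flow s z i).2)} ≤
        ENNReal.ofReal ε := by
  intro a₀ θ₀ u₀ ha hθ hu ha0 hθ0
  obtain ⟨σ₀, hσ₀, hσ⟩ := h a₀ θ₀ u₀ ha hθ hu ha0 hθ0
  refine ⟨σ₀, hσ₀, fun σ hσp hσl T ρ θ u hE Φ hLLN t ht ε hε δ hδ => ?_⟩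
  obtain ⟨M, N₀, hM⟩ := hσ σ hσp hσl T ρ θ u hE Φ hLLN t ht (ε * δ) (by positivity)
  refine ⟨M, N₀, fun N hN s hs => ?_⟩
  set μ := localGibbsLaw σ a₀ u₀ θ₀ N (Φ N) with hμ
  set Tf : Config (N + 1) (Fin 3) T3 → ℝ := fun z => ((N : ℝ) + 1)⁻¹ * ∑ i : Fin (N + 1),
    Set.indicator {v : V3 | M < ‖v‖} (fun v => ‖v‖ ^ 2) (((Φ N).flow s z i).2) with hTf
  have hTm : Measurable Tf := measurable_tailEnergy_flow (Φ N) _ M s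
  -- Markov: `δ · μ{δ < T} ≤ δ · μ{δ ≤ T} ≤ ∫ T ≤ ε δ`
  have hmarkov : ENNReal.ofReal δ * μ {z | ENNReal.ofReal δ ≤ ENNReal.ofReal (Tf z)} ≤
      ∫⁻ z, ENNReal.ofReal (Tf z) ∂μ :=
    mul_meas_ge_le_lintegral₀ hTm.ennreal_ofReal.aemeasurable _
  have hsub : {z | δ < Tf z} ⊆ {z | ENNReal.ofReal δ ≤ ENNReal.ofReal (Tf z)} :=
    fun z hz => ENNReal.ofReal_le_ofReal (le_of_lt hz)
  have hle : ENNReal.ofReal δ * μ {z | δ < Tf z} ≤ ENNReal.ofReal (ε * δ) :=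
    calc ENNReal.ofReal δ * μ {z | δ < Tf z}
        ≤ ENNReal.ofReal δ * μ {z | ENNReal.ofReal δ ≤ ENNReal.ofReal (Tf z)} :=
          mul_le_mul' le_rfl (measure_mono hsub)
      _ ≤ ∫⁻ z, ENNReal.ofReal (Tf z) ∂μ := hmarkov
      _ ≤ ENNReal.ofReal (ε * δ) := hM N hN s hs
  have hδ' : ENNReal.ofReal δ ≠ 0 := by simpa using hδ
  calc μ {z | δ < Tf z} = (ENNReal.ofReal δ)⁻¹ * (ENNReal.ofReal δ * μ {z | δ < Tf z}) := by
        rw [← mul_assoc, ENNReal.inv_mul_cancel hδ' ENNReal.ofReal_ne_top, one_mul]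
    _ ≤ (ENNReal.ofReal δ)⁻¹ * ENNReal.ofReal (ε * δ) := mul_le_mul' le_rfl hle
    _ = ENNReal.ofReal ε := by
        rw [ENNReal.ofReal_mul hε.le, ← mul_assoc, mul_comm ((ENNReal.ofReal δ)⁻¹),
          mul_assoc, mul_comm (ENNReal.ofReal δ)⁻¹, ← mul_assoc,
          mul_assoc (ENNReal.ofReal ε), ENNReal.mul_inv_cancel hδ' ENNReal.ofReal_ne_top, mul_one]

/-- **`KineticEnergyTails` is equivalent to its in-probability form.** -/
theorem kineticEnergyTails_iff_inProbability :
    KineticEnergyTails ↔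
    ∀ (a₀ θ₀ : T3 → ℝ) (u₀ : T3 → V3), Continuous a₀ → Continuous θ₀ → Continuous u₀ →
      (∀ x, 0 < a₀ x) → (∀ x, 0 < θ₀ x) → ∃ σ₀ : ℝ, 0 < σ₀ ∧ ∀ σ : ℝ, 0 < σ → σ < σ₀ →
      ∀ (T : ℝ) (ρ θ : ℝ → T3 → ℝ) (u : ℝ → T3 → V3), IsHardSphereEulerSolution σ T ρ u θ →
      ∀ Φ : (N : ℕ) → HardSphereFlow (Torus.geometry (Fin 3)) (hsDiameter σ N) (N + 1),
      TendstoHydroFieldsAt (fun N => localGibbsLaw σ a₀ u₀ θ₀ N (Φ N)) Φ ρ u θ 0 →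
      ∀ t ∈ Set.Ico 0 T, ∀ ε : ℝ, 0 < ε → ∀ δ : ℝ, 0 < δ → ∃ M : ℝ, ∃ N₀ : ℕ, ∀ N : ℕ, N₀ ≤ N →
      ∀ s ∈ Set.Icc 0 t,
      localGibbsLaw σ a₀ u₀ θ₀ N (Φ N) {z | δ < ((N : ℝ) + 1)⁻¹ * ∑ i : Fin (N + 1),
        Set.indicator {v : V3 | M < ‖v‖} (fun v => ‖v‖ ^ 2) (((Φ N).flow s z i).2)} ≤
        ENNReal.ofReal ε :=
  ⟨inProbability_of_kineticEnergyTails, kineticEnergyTails_of_inProbability⟩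

end InProbability

end Summit.AtomisticToContinuum.HydrodynamicLimit.Theorems

end
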